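import Literature.Computability.QuantumComplexity.PauliMomentStabilizerBounds

/-!
# Universal caps on Pauli-moment certificates of stabilizer fidelity (Parseval caps)

Sequel of `PauliMomentStabilizerBounds.lean` (namespace `Literature.Computability.QuantumComplexity.PauliMoments`).
For EVERY unit vector `ψ` on `n ≥ 1` qubits (inputs: `a_I(ψ) = 1` and Parseval `Σ_S |a_S(ψ)|² = 2ⁿ‖ψ‖⁴` only):

* (T2a) `moment_ge`: `W_k(ψ) ≥ (1 + (2ⁿ−1)/(2ⁿ+1)^{k−1})/2ⁿ` for `k ≥ 1` (identity term + Jensen on the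
  `4ⁿ − 1` off-identity terms); corollaries `moment_two_ge : W₂(ψ) ≥ 2/(2ⁿ+1)` — the flat-spectrum bound
  «`M₂(ψ) < log(d+1) − log 2`» of [LeoneOlivieroHamma2021, p. 3] — and `moment_ge_inv : W_k(ψ) ≥ 2⁻ⁿ`
  (all `n, k`). Hence the certificate `W_k^{1/(2k)}` of `PauliMomentStabilizerBounds` (T1) never drops
  below `2^{−n/(2k)}` (best power mean `k = 2`: `(2/(2ⁿ+1))^{1/4}`);
* (T2b) `supCap`: `2ⁿ − 1 ≤ (4ⁿ − 1)·m²` for every off-identity bound `m` (max ≥ rms), so the identity-separated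
  sup-certificate (T1′) never drops below `2^{−n/2}` (exactly, for even `n`).

These are CAPS in the certifying direction (lower bounds on the certificate VALUES for every state); whether
they are attained for `n ≥ 2` is not claimed ([LeoneOlivieroHamma2021] note the flat-spectrum extremiser is
not a positive operator).

## References

* [LeoneOlivieroHamma2021] L. Leone, S. F. E. Oliviero, A. Hamma, Phys. Rev. Lett. 128 (2022) 050402;
  arXiv:2106.12587, p. 3.
* [KempeEtAl2010] J. Kempe, O. Regev, F. Unger, R. de Wolf, Quantum Inf. Comput. 10 (2010) 361, §2 (Parseval).
-/

noncomputable section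

open Matrix Finset Literature.Computability.QuantumComplexity

namespace Literature.Computability.QuantumComplexity.PauliMoments

variable {n : ℕ}

/-! ### (T2) Method caps, valid for every unit vector -/

/-- `4ⁿ − 1 = (2ⁿ − 1)(2ⁿ + 1)` over `ℝ` (arithmetic plumbing for the Parseval cap). [folklore] -/
private theorem four_pow_sub_one (n : ℕ) : (4 : ℝ) ^ n - 1 = (2 ^ n - 1) * (2 ^ n + 1) := by
  have h4 : (4 : ℝ) ^ n = (2 ^ n) ^ 2 := by
    rw [show (4 : ℝ) = 2 ^ 2 by norm_num, ← pow_mul, ← pow_mul, mul_comm]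
  rw [h4]; ring

/-- The non-identity Pauli mass of a unit vector: `Σ_{S ≠ I} |a_S(ψ)|² = 2ⁿ − 1`.
[cite: KempeEtAl2010, §2] -/
theorem sum_erase_norm_sq (ψ : Reg n → ℂ) (hψ : normSq ψ = 1) :
    ∑ S ∈ Finset.univ.erase (idWord n), ‖pauliExp ψ S‖ ^ 2 = 2 ^ n - 1 := by
  have h := Finset.add_sum_erase Finset.univ (fun S => ‖pauliExp ψ S‖ ^ 2) (Finset.mem_univ (idWord n))
  rw [sum_norm_pauliExp_sq, hψ, pauliExp_idWord, hψ] at h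
  simp only [Complex.ofReal_one, norm_one, one_pow] at h
  linarith

/-- **(T2a) moment cap**: for every unit vector on `n ≥ 1` qubits and every `k ≥ 1`,
`W_k(ψ) ≥ (1 + (2ⁿ−1)/(2ⁿ+1)^{k−1})/2ⁿ` (identity term plus Jensen on the other `4ⁿ − 1` terms,
whose squares sum to `2ⁿ − 1`). Consequence: the certificate `W_k^{1/(2k)}` of (T1) is at least
`2^{−n/(2k)}` for every state. [cite: LeoneOlivieroHamma2021, eq. (6) (M₂ < log₂ d bound area)] -/
theorem moment_ge (hn : 1 ≤ n) (ψ : Reg n → ℂ) (hψ : normSq ψ = 1) (k : ℕ) (hk : 1 ≤ k) :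
    (1 + (2 ^ n - 1) / (2 ^ n + 1) ^ (k - 1)) / 2 ^ n ≤ moment k ψ := by
  set E : Finset (PWord n) := Finset.univ.erase (idWord n) with hE
  set z : PWord n → ℝ := fun S => ‖pauliExp ψ S‖ ^ 2 with hz
  have hzI : z (idWord n) = 1 := by simp [hz, pauliExp_idWord, hψ]
  have hsumE : ∑ S ∈ E, z S = 2 ^ n - 1 := sum_erase_norm_sq ψ hψ
  have hcardE : (E.card : ℝ) = 4 ^ n - 1 := by
    rw [hE, Finset.card_erase_of_mem (Finset.mem_univ _), Finset.card_univ, card_pword,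
      Nat.cast_sub (Nat.one_le_pow _ _ (by norm_num))]
    push_cast; ring
  have hN : (0 : ℝ) < 4 ^ n - 1 := by
    have : (4 : ℝ) ≤ 4 ^ n := by
      calc (4 : ℝ) = 4 ^ 1 := by norm_num
        _ ≤ 4 ^ n := pow_le_pow_right₀ (by norm_num) hn
    linarith
  have h2n : (2 : ℝ) ^ n - 1 ≠ 0 := by
    have : (2 : ℝ) ≤ 2 ^ n := by
      calc (2 : ℝ) = 2 ^ 1 := by norm_num
        _ ≤ 2 ^ n := pow_le_pow_right₀ (by norm_num) hn
    linarith
  -- Jensen on E with uniform weights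
  have hw : ∑ _S ∈ E, (1 : ℝ) / (4 ^ n - 1) = 1 := by
    rw [Finset.sum_const, nsmul_eq_mul, hcardE]; field_simp
  have hJ := Real.pow_arith_mean_le_arith_mean_pow E (fun _ => (1 : ℝ) / (4 ^ n - 1)) z
    (fun _ _ => by positivity) hw (fun _ _ => by positivity) k
  rw [← Finset.mul_sum, ← Finset.mul_sum, hsumE] at hJ
  -- hJ : (1/(4^n-1) * (2^n-1))^k ≤ 1/(4^n-1) * Σ_E z^k
  have havg : (1 : ℝ) / (4 ^ n - 1) * (2 ^ n - 1) = 1 / (2 ^ n + 1) := by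
    rw [four_pow_sub_one]
    field_simp [h2n]
  rw [havg] at hJ
  have hrest : (2 ^ n - 1) / (2 ^ n + 1) ^ (k - 1) ≤ ∑ S ∈ E, z S ^ k := by
    have h1 : (4 ^ n - 1) * (1 / (2 ^ n + 1)) ^ k ≤ ∑ S ∈ E, z S ^ k := by
      have := mul_le_mul_of_nonneg_left hJ hN.le
      rwa [← mul_assoc, mul_one_div_cancel hN.ne', one_mul] at this
    refine le_trans (le_of_eq ?_) h1
    obtain ⟨j, rfl⟩ : ∃ j, k = j + 1 := ⟨k - 1, by omega⟩
    have h2n1 : (2 : ℝ) ^ n + 1 ≠ 0 := by positivity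
    rw [Nat.add_sub_cancel]
    calc ((2 : ℝ) ^ n - 1) / (2 ^ n + 1) ^ j
        = (2 ^ n - 1) * (2 ^ n + 1) / ((2 ^ n + 1) ^ j * (2 ^ n + 1)) :=
          (mul_div_mul_right _ _ h2n1).symm
      _ = (4 ^ n - 1) * (1 / (2 ^ n + 1)) ^ (j + 1) := by
          rw [four_pow_sub_one, ← pow_succ, one_div, inv_pow, div_eq_mul_inv]
  -- assemble
  have hsplit : moment k ψ = (z (idWord n) ^ k + ∑ S ∈ E, z S ^ k) / 2 ^ n := by
    unfold moment
    rw [← Finset.add_sum_erase Finset.univ _ (Finset.mem_univ (idWord n))]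
    simp only [hz, hE, pow_mul]
  rw [hsplit, hzI, one_pow]
  gcongr

/-- **(T2a, k = 2)**: `W₂(ψ) ≥ 2/(2ⁿ + 1)` for every unit vector (`n ≥ 1`); equivalently
`M₂(ψ) ≤ log₂(2ⁿ+1) − 1`, so the 4th-moment certificate is at least `(2/(2ⁿ+1))^{1/4} ≈ 2^{−n/4}`.
[cite: LeoneOlivieroHamma2021, eq. (6)] -/
theorem moment_two_ge (hn : 1 ≤ n) (ψ : Reg n → ℂ) (hψ : normSq ψ = 1) :
    2 / (2 ^ n + 1) ≤ moment 2 ψ := by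
  have h := moment_ge hn ψ hψ 2 (by norm_num)
  have he : (1 + (2 ^ n - 1) / (2 ^ n + 1) ^ (2 - 1)) / 2 ^ n = (2 : ℝ) / (2 ^ n + 1) := by
    norm_num
    field_simp
    ring
  rwa [he] at h

/-- **(T2a, all k)**: `W_k(ψ) ≥ 2⁻ⁿ` from the identity term `a_I(ψ) = 1` alone (every `n`, every `k`).
Arithmetic on [cite: LeoneOlivieroHamma2021, eq. (1)–(2)]. -/
theorem moment_ge_inv (ψ : Reg n → ℂ) (hψ : normSq ψ = 1) (k : ℕ) : 1 / 2 ^ n ≤ moment k ψ := by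
  unfold moment
  gcongr
  have h := Finset.single_le_sum (f := fun S : PWord n => ‖pauliExp ψ S‖ ^ (2 * k))
    (fun S _ => by positivity) (Finset.mem_univ (idWord n))
  simpa [pauliExp_idWord, hψ] using h

/-- **(T2b) sup cap**: any off-identity bound `m` (`|a_S(ψ)| ≤ m` for all `S ≠ I`) of a unit
vector satisfies `2ⁿ − 1 ≤ (4ⁿ − 1)·m²`, i.e. `m ≥ (2ⁿ+1)^{−1/2}`; so the sup-certificate of (T1')
is at least `(1 + (2ⁿ−1)(2ⁿ+1)^{−1/2})/2ⁿ ≈ 2^{−n/2}`. [cite: KempeEtAl2010, §2] -/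
theorem supCap (ψ : Reg n → ℂ) (hψ : normSq ψ = 1) (m : ℝ)
    (hm : ∀ S, S ≠ idWord n → ‖pauliExp ψ S‖ ≤ m) : (2 : ℝ) ^ n - 1 ≤ (4 ^ n - 1) * m ^ 2 := by
  rw [← sum_erase_norm_sq ψ hψ]
  have hcard : ((Finset.univ.erase (idWord n)).card : ℝ) = 4 ^ n - 1 := by
    rw [Finset.card_erase_of_mem (Finset.mem_univ _), Finset.card_univ, card_pword,
      Nat.cast_sub (Nat.one_le_pow _ _ (by norm_num))]
    push_cast; ring
  calc ∑ S ∈ Finset.univ.erase (idWord n), ‖pauliExp ψ S‖ ^ 2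
      ≤ ∑ _S ∈ Finset.univ.erase (idWord n), m ^ 2 :=
        Finset.sum_le_sum fun S hS =>
          pow_le_pow_left₀ (norm_nonneg _) (hm S (Finset.mem_erase.1 hS).1) 2
    _ = (4 ^ n - 1) * m ^ 2 := by rw [Finset.sum_const, nsmul_eq_mul, hcard]

end Literature.Computability.QuantumComplexity.PauliMoments

end
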